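import Summits.ABC.StewartYu.ArchG3LineSupply
import HarnessLib

/-!
# Cell abc-stewartyu, WP-L.A (crux r2 `ArchCoreRat`, stmt-ABC-20502), line `arch-g3-frame` v4: the SUPPLIES on a SHAPED saturated frame
# (plan RULINGS R45/R47: the START exports the four shape letters of the Hermite-reduced lower-triangular basis; registrar p4 g10)

`Summits/ABC/StewartYu/ArchG3LineSupplyS.lean` — sequel of `ArchG3LineSupply.lean` (same vocabulary; `RecordSupply`, `EndLetters`, the
`ν`-injectivity and `endLetters_holds` are reused from there).  Plain `Prop`-valued definitions (the REGISTERED texts of the two open stubs of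
the r2 line) and the composition theorem; no named fact, no numerics.

WHY A SEQUEL (p5 g9 20:57/21:03Z, ref g37 21:13/21:27Z, plan R47): the letter lines `ArchLinesHoldV` are FALSE on a skew saturated basis
(family `a = (2, 2q²)`, `N = 2`, `q → ∞`: the θ-charged jets/Δ atoms cost `log A_max` per derivative, which the record's `W + log N` does not
pay); they hold on the weight-sorted LOWER-triangular Hermite-reduced basis with the pivot at the LAST index (= maximal weight, `Monotone A`).
So the START must EXPORT, and the lines CONSUME, the four shape letters
`(∀ k j, k < j → U k j = 0) ∧ (∀ k j, 0 ≤ U k j ≤ N) ∧ (∀ j k, |C j k| ≤ (n−1)!·N) ∧ (∀ j, j ≤ j̃₀)` — supplied by p5's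
`SatBasisReduced.exists_reduced_satFrame_lower` (drop-in for the kit).  Everything else is `ArchG3LineSupply` verbatim:

* **`StartSupplyS c`** (stub `stub_satStartArch`) — `StartDataS` = `StartData` + the four shape conjuncts;
* **`LinesSupplyS c`** (stub `stub_recLinesArch`, p5) — `LinesSupply` + the four shape hypotheses;
* `frameArchW_of_suppliesS : StartSupplyS c → LinesSupplyS c → (record at c) → EndLetters → ∀ n ≥ 2, ∃ Y, FrameArchW (c^·) Y n`
  (the shape letters are passed from the START to the lines; the rest of the composition is unchanged).

WHAT THIS IS NOT: no START, no lines (those are the stubs); no crux moves by itself.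

References: Yu. V. Nesterenko, LNM 1819 (2003), §3.4–3.5 (Hermite-reduced basis of 𝔑, pp. 66–78), §4 Prop. 4.1, §4.3 Cor. 4.5, §5.1–5.2;
E. M. Matveev, Izv. Math. 64 (2000), (1.3); J. W. S. Cassels, *Geometry of Numbers*, Ch. I §2.2 (Hermite normal form).
-/

noncomputable section

open Finset
open scoped Matrix
open Summit.ABC.StewartYu.GenThreeFrameSpecArchW (RecordArchW FrameArchW)
open Summit.ABC.StewartYu.FeldmanBasis (feldR)
open Summit.ABC.StewartYu.ArchG3FrameGlue (setupOf)

namespace Summit.ABC.StewartYu.ArchG3Line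

/-! ### The supplies on a shaped frame (registered texts of the open stubs) -/

/-- **What the START owes for one datum at the constant `c`, WITH THE SHAPE LETTERS of the Hermite-reduced LOWER-triangular basis**
(`U k j = 0` for `k < j`, `0 ≤ U ≤ N`, `|C| ≤ (n−1)!·N`, pivot `j̃₀` = the LAST index = maximal weight; see the module docstring). [cite: Nesterenko2003, §3.5 (3.22)–(3.30),
Prop. 3.9, §4 (4.6); shape only] -/
def StartDataS (c : ℝ) (n : ℕ) (a : Fin n → ℚ) (b : Fin n → ℤ) (A : Fin n → ℝ) (B : ℝ) : Prop :=
  ∃ (θ : Fin n → ℚ) (hθ : ∀ i, 0 < θ i) (bt : Fin n → ℤ) (jt : Fin n) (hjt : bt jt ≠ 0)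
    (F : (setupOf n θ hθ bt jt hjt).SatData) (P : ArchG3Rec n),
    F.αo = a ∧ F.bo = b ∧ P.A = A ∧ P.N = F.N ∧ F.C.det.natAbs = F.N ∧ P.W = Real.log (Real.exp 1 * B) ∧
    (∀ k j : Fin n, k < j → F.U k j = 0) ∧ (∀ k j : Fin n, 0 ≤ F.U k j ∧ F.U k j ≤ (F.N : ℤ)) ∧
    (∀ j k : Fin n, |F.C j k| ≤ ((n - 1).factorial : ℤ) * F.N) ∧ (∀ j : Fin n, j ≤ jt) ∧
    (∀ T₁ : Finset (Fin n), T₁.Nonempty → ¬ IsSquare (∏ j ∈ T₁, θ j)) ∧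
    |(setupOf n θ hθ bt jt hjt).Λ / (bt jt : ℝ)| ≤ Real.exp (-(c ^ n * P.Ω * P.W)) ∧
    ∀ (cl : ℕ → ℤ) (el : ℕ → Fin n → ℤ), cl 0 ≠ 0 → el 0 jt = 0 →
      ∃ (𝔏 : Finset (Fin n → ℤ)) (pv : ℕ × (Fin n → ℤ) → ℤ),
        (∀ i ∈ (setupOf n θ hθ bt jt hjt).unkA P.L₀ 𝔏, i.1 ≤ P.L₀) ∧
        ((setupOf n θ hθ bt jt hjt).unkA P.L₀ 𝔏).card ≤ (P.L₀ + 1) * ∏ j, ((setupOf n θ hθ bt jt hjt).LνR P 0 j + 1) ∧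
        (setupOf n θ hθ bt jt hjt).ArchLevelStateQ
          ((setupOf n θ hθ bt jt hjt).VBoxQ (Matrix.vecMulLinear F.U).toAddMonoidHom ((setupOf n θ hθ bt jt hjt).LνR P))
          P.H P.Sd ((setupOf n θ hθ bt jt hjt).sθR F P) ((setupOf n θ hθ bt jt hjt).unkA P.L₀ 𝔏) pv
          ⌈((((setupOf n θ hθ bt jt hjt).unkA P.L₀ 𝔏).card : ℕ) : ℝ) * (setupOf n θ hθ bt jt hjt).AmaxR F P (cl 0) (el 0)⌉
          P.wl P.γb cl el 0 (P.Nf 0 0) (P.Tf 0 0)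

/-- **THE START SUPPLY at the constant `c`, shape letters included** (text of `stub_satStartArch`, v4): every REDUCED pivot-weighted rank-`n` datum (`n ≥ 2`) under the
negated bound `log|Λ| < −cⁿ·Ω·log(eB)` and in the regime `cⁿ·Ω·log(eB) < Σ Aⱼ|bⱼ| + log 2` receives `StartDataS c n a b A B`.
[cite: Nesterenko2003, §3.5, §4 (4.6); shape only] -/
def StartSupplyS (c : ℝ) : Prop :=
  ∀ n, 2 ≤ n → ∀ (a : Fin n → ℚ) (b : Fin n → ℤ) (A : Fin n → ℝ) (B : ℝ) (k₀ : Fin n),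
    (∀ j, 0 < a j) →
    (∀ μ : Fin n → ℤ, ∏ j, a j ^ μ j = 1 → μ = 0) →
    (∀ j, Height.logHeight₁ (a j) ≤ A j) → (∀ j, 1 ≤ A j) →
    (∀ j, b j ≠ 0) → Finset.univ.gcd b = 1 → Monotone A → (∀ j, A j ≤ A k₀) →
    (∀ j, (|b j| : ℝ) * A j ≤ B * A k₀) →
    ¬ -(c ^ n * (∏ j, A j) * Real.log (Real.exp 1 * B)) ≤ Real.log |∑ j, (b j : ℝ) * Real.log (a j : ℝ)| →
    c ^ n * (∏ j, A j) * Real.log (Real.exp 1 * B) < ∑ j, A j * |(b j : ℝ)| + Real.log 2 →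
    StartDataS c n a b A B

/-- **THE LETTER-LINES SUPPLY at the constant `c`, on a SHAPED frame** (text of `stub_recLinesArch`, v4): for every datum as in `StartSupply` and every START output
`(θ, b̃, j̃₀, F, P)` on the datum's letters, a direction schedule `(cl, el)` with `cl 0 ≠ 0`, `el 0 j̃₀ = 0` such that for every Siegel family
`𝔏` within the START's degree/count bounds (and non-empty) the per-level letter lines `ArchLinesHoldV` hold at the record's schedules with
`δ₀ := exp(−cⁿ·P.Ω·P.W)`; the frame carries the four SHAPE letters (lower-triangular `U`, Hermite box, adjugate bound, last-index pivot),
without which the lines are false for skew bases (p5 g9 Claim 1, ref g37 21:13Z/21:27Z). [cite: Nesterenko2003, §4.2 (4.20)–(4.35), §4.3 (4.36)–(4.51); shape only] -/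
def LinesSupplyS (c : ℝ) : Prop :=
  ∀ n, 2 ≤ n → ∀ (a : Fin n → ℚ) (b : Fin n → ℤ) (A : Fin n → ℝ) (B : ℝ) (k₀ : Fin n),
    (∀ j, 0 < a j) →
    (∀ μ : Fin n → ℤ, ∏ j, a j ^ μ j = 1 → μ = 0) →
    (∀ j, Height.logHeight₁ (a j) ≤ A j) → (∀ j, 1 ≤ A j) →
    (∀ j, b j ≠ 0) → Finset.univ.gcd b = 1 → Monotone A → (∀ j, A j ≤ A k₀) →
    (∀ j, (|b j| : ℝ) * A j ≤ B * A k₀) →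
    ¬ -(c ^ n * (∏ j, A j) * Real.log (Real.exp 1 * B)) ≤ Real.log |∑ j, (b j : ℝ) * Real.log (a j : ℝ)| →
    c ^ n * (∏ j, A j) * Real.log (Real.exp 1 * B) < ∑ j, A j * |(b j : ℝ)| + Real.log 2 →
    ∀ (θ : Fin n → ℚ) (hθ : ∀ i, 0 < θ i) (bt : Fin n → ℤ) (jt : Fin n) (hjt : bt jt ≠ 0)
      (F : (setupOf n θ hθ bt jt hjt).SatData) (P : ArchG3Rec n),
      F.αo = a → F.bo = b → P.A = A → P.N = F.N → F.C.det.natAbs = F.N → P.W = Real.log (Real.exp 1 * B) →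
      (∀ k j : Fin n, k < j → F.U k j = 0) → (∀ k j : Fin n, 0 ≤ F.U k j ∧ F.U k j ≤ (F.N : ℤ)) →
      (∀ j k : Fin n, |F.C j k| ≤ ((n - 1).factorial : ℤ) * F.N) → (∀ j : Fin n, j ≤ jt) →
      (∀ T₁ : Finset (Fin n), T₁.Nonempty → ¬ IsSquare (∏ j ∈ T₁, θ j)) →
      ∃ (cl : ℕ → ℤ) (el : ℕ → Fin n → ℤ), cl 0 ≠ 0 ∧ el 0 jt = 0 ∧
        ∀ (𝔏 : Finset (Fin n → ℤ)),
          (∀ i ∈ (setupOf n θ hθ bt jt hjt).unkA P.L₀ 𝔏, i.1 ≤ P.L₀) →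
          ((setupOf n θ hθ bt jt hjt).unkA P.L₀ 𝔏).card ≤ (P.L₀ + 1) * ∏ j, ((setupOf n θ hθ bt jt hjt).LνR P 0 j + 1) →
          1 ≤ ((setupOf n θ hθ bt jt hjt).unkA P.L₀ 𝔏).card →
          (setupOf n θ hθ bt jt hjt).ArchLinesHoldV F P.H P.Sd ((setupOf n θ hθ bt jt hjt).sθR F P)
            ((setupOf n θ hθ bt jt hjt).unkA P.L₀ 𝔏)
            ⌈((((setupOf n θ hθ bt jt hjt).unkA P.L₀ 𝔏).card : ℕ) : ℝ) * (setupOf n θ hθ bt jt hjt).AmaxR F P (cl 0) (el 0)⌉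
            (Real.exp (-(c ^ n * P.Ω * P.W))) P.wl P.γb cl el ((setupOf n θ hθ bt jt hjt).LνR P) P.Nf P.Tf P.Nh

/-! ### Composition -/

/-- **THE COMPOSITION (shaped frame)**: at a constant `c`, the START supply, the letter-lines supply, a record supply at this `c` and the END letters give the
archimedean frame `FrameArchW (c^·) Y n` at every rank `n ≥ 2` — lines ⇒ packs (✓ `archPacksHoldV_of_linesHoldV`), packs ⇒ last level
(✓ `lastLevelStateQ_of_packsV` with `Q := VBoxQ`, hooks ✓ `vboxQ_halfStep`/`vboxV_of_vboxQ`), last level ⇒ `EndAt` (✓ `lastLevelInv_feldR`,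
box enlarged to the END degrees), `EndAt` ⇒ frame (✓ `frameArchW_of_endAt`). [cite: Nesterenko2003, §4 Prop. 4.1, §5.1–5.2] -/
theorem frameArchW_of_suppliesS {c : ℝ} (hS : StartSupplyS c) (hL : LinesSupplyS c)
    (hR : ∀ n : ℕ, 2 ≤ n → ∃ Y : ℕ → ℝ, ∀ P : ArchG3Rec n, RecordArchW (fun r => c ^ r) Y n P.A P.D₀ P.S₀ P.Xfin P.D)
    (hE : EndLetters) : ∀ n, 2 ≤ n → ∃ Y : ℕ → ℝ, FrameArchW (fun r => c ^ r) Y n := by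
  classical
  intro n hn
  obtain ⟨Y, hY⟩ := hR n hn
  refine ⟨Y, ?_⟩
  intro a b A B k₀ ha hind hA hA1 hbz hgcd hmono hmax hBw hneg hreg
  obtain ⟨θ, hθ, bt, jt, hjt, F, P, hαo, hbo, hPA, hPN, hdet, hPW, hUtri, hUbox, hCbd, hlast, hindθ, hΛ, hstart⟩ :=
    hS n hn a b A B k₀ ha hind hA hA1 hbz hgcd hmono hmax hBw hneg hreg
  obtain ⟨cl, el, hc0, he0, hlines⟩ :=
    hL n hn a b A B k₀ ha hind hA hA1 hbz hgcd hmono hmax hBw hneg hreg θ hθ bt jt hjt F P hαo hbo hPA hPN hdet hPW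
      hUtri hUbox hCbd hlast hindθ
  obtain ⟨𝔏, pv, hdeg, hcount, h00⟩ := hstart cl el hc0 he0
  -- the unknown set is non-empty (the level-`0` function is non-zero)
  have hU1 : 1 ≤ ((setupOf n θ hθ bt jt hjt).unkA P.L₀ 𝔏).card := by
    obtain ⟨B₀, v₀, lo₀, γ₀, hBU₀, -, -, hinv₀, -⟩ := h00
    obtain ⟨i, hi, -⟩ := hinv₀.nonzero
    exact Finset.card_pos.mpr ⟨i, hBU₀ hi⟩
  have hlin := hlines 𝔏 hdeg hcount hU1
  have hpacks := (setupOf n θ hθ bt jt hjt).archPacksHoldV_of_linesHoldV F hlin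
  -- the schedule hooks
  have hn1 : 1 ≤ (setupOf n θ hθ bt jt hjt).n := by show 1 ≤ n; omega
  have hΛ' : |(setupOf n θ hθ bt jt hjt).Λ / ((setupOf n θ hθ bt jt hjt).b (setupOf n θ hθ bt jt hjt).j₀ : ℝ)| ≤ Real.exp (-(c ^ n * P.Ω * P.W)) := hΛ
  have hQhalf : ∀ (lev : ℕ) (B₁ : Finset (ℕ × (Fin n → ℤ))) (v : ℕ × (Fin n → ℤ) → Fin n → ℤ) (i₀ : ℕ × (Fin n → ℤ)),
      i₀ ∈ B₁ → (setupOf n θ hθ bt jt hjt).VBoxQ (Matrix.vecMulLinear F.U).toAddMonoidHom ((setupOf n θ hθ bt jt hjt).LνR P) B₁ v lev →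
      (setupOf n θ hθ bt jt hjt).VBoxQ (Matrix.vecMulLinear F.U).toAddMonoidHom ((setupOf n θ hθ bt jt hjt).LνR P) ((setupOf n θ hθ bt jt hjt).parityClass v B₁ i₀) ((setupOf n θ hθ bt jt hjt).halfDiff v i₀) (lev + 1) :=
    fun lev B₁ v i₀ hi₀ hQ => ArchG3Setup.vboxQ_halfStep (fun j => (setupOf n θ hθ bt jt hjt).LνR_succ P lev j) hi₀ hQ
  have hQV : ∀ (lev : ℕ) (B₁ : Finset (ℕ × (Fin n → ℤ))) (v : ℕ × (Fin n → ℤ) → Fin n → ℤ),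
      (setupOf n θ hθ bt jt hjt).VBoxQ (Matrix.vecMulLinear F.U).toAddMonoidHom ((setupOf n θ hθ bt jt hjt).LνR P) B₁ v lev → ∀ i ∈ B₁, ∀ j, |(v i ᵥ* F.U) j| ≤ ((setupOf n θ hθ bt jt hjt).LνR P lev j : ℤ) :=
    fun lev B₁ v hQ i hi j => ArchG3Setup.vboxV_of_vboxQ lev B₁ v hQ i hi j
  have hwl : ∀ lev, P.wl (lev + 1) = P.wl lev / 2 := fun lev => (P.wl_facts lev).1
  have hγb : ∀ lev, P.wl lev / 2 ≤ P.γb (lev + 1) := fun lev => (P.γb_facts lev).2.2.1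
  have hlast := (setupOf n θ hθ bt jt hjt).lastLevelStateQ_of_packsV F hn1 hindθ hΛ' hQhalf hQV hwl hγb hpacks h00
  obtain ⟨Bf, v, lo, γ, hBU, hinj, hinv, hQ⟩ := ArchG3Setup.lastLevelInv_feldR hlast
  -- the END letters and the record
  obtain ⟨hLD, hL0D0, hX, hSlt⟩ := hE (setupOf n θ hθ bt jt hjt) P
  have hrec : RecordArchW (fun r => c ^ r) Y n A P.D₀ P.S₀ P.Xfin P.D := by rw [← hPA]; exact hY P
  -- the saturation relations over the original datum
  have hN1 : 1 ≤ F.N := F.hN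
  have hUrel : ∀ i, θ i ^ F.N = ∏ j, a j ^ F.U i j := by
    intro i; rw [← hαo]; exact F.hU i
  have hbU : bt ᵥ* F.U = (F.N : ℤ) • b := by
    rw [← hbo]; exact F.N_smul_bo_eq.symm
  have hνinj := vecMul_U_injective F
  have hdegD : ∀ i ∈ Bf, i.1 ≤ P.D₀ := fun i hi => (hdeg i (hBU hi)).trans hL0D0
  have hbox : ∀ i ∈ Bf, ∀ j, |(v i ᵥ* F.U) j| ≤ (P.D j : ℤ) := by
    intro i hi j
    have h1 := hQV P.Sd Bf v hQ i hi j
    have h2 : ((setupOf n θ hθ bt jt hjt).LνR P P.Sd j : ℤ) ≤ (P.D j : ℤ) := by exact_mod_cast hLD j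
    exact h1.trans h2
  have hEnd : EndAt c Y n a b A :=
    ⟨θ, hθ, bt, jt, hjt, F.U, F.N, P.H, Bf, v, pv, lo, (setupOf n θ hθ bt jt hjt).Lb ((setupOf n θ hθ bt jt hjt).sθR F P) P.Sd,
      ⌈((((setupOf n θ hθ bt jt hjt).unkA P.L₀ 𝔏).card : ℕ) : ℝ) * (setupOf n θ hθ bt jt hjt).AmaxR F P (cl 0) (el 0)⌉, P.wl P.Sd, γ, cl P.Sd, el P.Sd,
      P.Nf P.Sd n, P.Tf P.Sd n, P.D₀, P.S₀, P.Xfin, P.D, hN1, hUrel, hbU, hνinj, hinv, hdegD, hinj, hbox, hX, hSlt, hrec⟩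
  exact frameArchW_of_endAt c Y n a b A k₀ ha hind (hbz k₀) hEnd


end Summit.ABC.StewartYu.ArchG3Line

end
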